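import Literature.MathematicalPhysics.QuantumManyBody.BoseGasFreeDirichletBEC
import HarnessLib

/-!
# Route `BECRieszReverseHolder`, crux `MicroscaleFlatness` (stmt-AtomisticToContinuum-12842),
# line registered (`Lines/birth.lean`): the registered stub `stub_badMass_le_sliceKinetic`

Supports (does not close) stmt-AtomisticToContinuum-12842; stub `stub_badMass_le_sliceKinetic`
(Poincaré–Wirtinger kinetic localisation on bad cubes) of the birth line.

**Statement.** There is an absolute constant `C` (here `C = 1/π²`, the inverse Neumann gap of the
unit cube) such that for every trial state `Ψ` of `n+1` bosons in `Λ_L`, every `m ≥ 1` and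
`0 < c₀ < 1`, partitioning `[0,L)³` into the `m³` half-open cubes
`Q_k = ∏ᵢ [kᵢ L/m, (kᵢ+1) L/m)` (`k : Fin 3 → Fin m`), the environment-integrated mass of the BAD
cubes of the slice `y ↦ Ψ(y, X)` — those with `(∫_Q ‖Ψ‖)² < c₀ |Q| ∫_Q ‖Ψ‖²` — is at most
`C (L/m)²/(1 - c₀) · ∫ dX ∫ dy |∇₀Ψ(y, X)|²`.

**Proof.** Per cube (`bad_cellShift_le`): the tree's additive sharp Poincaré inequality on a
translated cube `Q = a + [0,s)³` (`local_poincare_cellShift`,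
`(π/s)² ∫_Q |f|² ≤ ∫_Q |∇f|² + (π/s)² s⁻³ ‖∫_Q f‖²`) and `‖∫_Q f‖ ≤ ∫_Q ‖f‖` turn the bad-cube
test into `(π/s)² ∫_Q|f|² ≤ ∫_Q|∇f|² + (π/s)² c₀ ∫_Q |f|²`, whence
`∫_Q |f|² ≤ (s/π)²/(1-c₀) ∫_Q |∇f|²` (`ennreal_absorb`; `∫_Q |f|² < ∞` by continuity). Then the
cubes `Q_k = subCell s k` are disjoint (`sum_setLIntegral_subCell_le`), the slice gradient is
`partialGradSq 0` (`gradSqC_vecCons_eq_partialGradSq`), and one integrates over `X`.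

## References

* [LSSY2005] E. H. Lieb, R. Seiringer, J. P. Solovej, J. Yngvason, *The Mathematics of the Bose
  Gas and its Condensation* (2005), Ch. 5 (5.15)–(5.17) (Poincaré / gap method on sub-cubes).
* L. E. Payne, H. F. Weinberger, *An optimal Poincaré inequality for convex domains*, Arch.
  Rational Mech. Anal. 5 (1960) 286–292 (the sharp constant).
-/

noncomputable section

open MeasureTheory
open scoped ENNReal NNReal

namespace Summit.AtomisticToContinuum.BoseEinsteinCondensation.Theorems.MicroscaleFlatness

open Literature.MathematicalPhysics.QuantumManyBody.BoseGas

namespace BadMass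

/-- `ℝ≥0∞` bookkeeping: if `P W ≤ G + P c W` with `c < 1`, `W < ∞` and `0 < P < ∞`, then
`W ≤ (P (1 - c))⁻¹ G`. [folklore] -/
theorem ennreal_absorb {P c W G : ℝ≥0∞} (hP0 : P ≠ 0) (hPt : P ≠ ⊤) (hc : c < 1) (hW : W ≠ ⊤)
    (h : P * W ≤ G + P * (c * W)) : W ≤ (P * (1 - c))⁻¹ * G := by
  have hct : c ≠ ⊤ := ne_top_of_lt hc
  have h1 : P * W - P * (c * W) ≤ G := tsub_le_iff_right.mpr h
  have h2 : P * W - P * (c * W) = P * (1 - c) * W := by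
    rw [mul_assoc, ENNReal.sub_mul (fun _ _ => hW), one_mul,
      ENNReal.mul_sub (fun _ _ => hPt)]
  rw [h2] at h1
  have ha0 : P * (1 - c) ≠ 0 := mul_ne_zero hP0 (tsub_pos_of_lt hc).ne'
  have hat : P * (1 - c) ≠ ⊤ :=
    ENNReal.mul_ne_top hPt (ne_top_of_le_ne_top ENNReal.one_ne_top tsub_le_self)
  calc W = (P * (1 - c))⁻¹ * (P * (1 - c) * W) := by
        rw [← mul_assoc, ENNReal.inv_mul_cancel ha0 hat, one_mul]
    _ ≤ (P * (1 - c))⁻¹ * G := by gcongr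

/-- The squared `L²`-mass of a continuous function on a translated cube is finite. [folklore] -/
theorem setLIntegral_nnnorm_sq_cellShift_ne_top {s : ℝ} {f : Space → ℂ} (hf : Continuous f)
    (a : Space) : ∫⁻ y in cellShift s a, (‖f y‖₊ : ℝ≥0∞) ^ 2 ≠ ⊤ := by
  have h1 : ∫⁻ y in cellShift s a, (‖f y‖₊ : ℝ≥0∞) ^ 2 =
      ∫⁻ x in cell s, (‖f (x + a)‖₊ : ℝ≥0∞) ^ 2 :=
    (setLIntegral_cell_comp_add s (fun x => (‖f x‖₊ : ℝ≥0∞) ^ 2) a).symm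
  have hi : IntegrableOn (fun x : Space => ‖f (x + a)‖ ^ 2) (cell s) volume :=
    integrableOn_sq_cell s (hf.comp (continuous_id.add continuous_const))
  rw [h1]
  simp_rw [coe_nnnorm_sq_eq_ofReal]
  exact hi.lintegral_lt_top.ne

/-- **Per-cube step.** On a translated cube `Q = a + [0,s)³`, a `C¹` function `f` whose cube is
BAD, `(∫_Q ‖f‖)² < c₀ s³ ∫_Q ‖f‖²` with `c₀ < 1`, satisfies
`∫_Q ‖f‖² ≤ (1/π²) s²/(1 - c₀) ∫_Q |∇f|²` (sharp Neumann gap of the cube + `‖∫f‖ ≤ ∫‖f‖`).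
[cite: LSSY2005, Ch. 5 (5.15)–(5.17)] -/
theorem bad_cellShift_le {s c₀ : ℝ} (hs : 0 < s) (hc₀ : 0 ≤ c₀) (hc₁ : c₀ < 1) {f : Space → ℂ}
    (hf : ContDiff ℝ 1 f) (a : Space)
    (hbad : (∫⁻ y in cellShift s a, (‖f y‖₊ : ℝ≥0∞)) ^ 2 <
      ENNReal.ofReal (c₀ * s ^ 3) * ∫⁻ y in cellShift s a, (‖f y‖₊ : ℝ≥0∞) ^ 2) :
    ∫⁻ y in cellShift s a, (‖f y‖₊ : ℝ≥0∞) ^ 2 ≤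
      ENNReal.ofReal (1 / Real.pi ^ 2 * s ^ 2 / (1 - c₀)) * ∫⁻ y in cellShift s a, gradSqC f y := by
  set W := ∫⁻ y in cellShift s a, (‖f y‖₊ : ℝ≥0∞) ^ 2 with hW_def
  set G := ∫⁻ y in cellShift s a, gradSqC f y with hG_def
  set P : ℝ≥0∞ := ENNReal.ofReal ((Real.pi / s) ^ 2) with hP_def
  have hP0 : P ≠ 0 := (ENNReal.ofReal_pos.2 (by positivity)).ne'
  have hPt : P ≠ ⊤ := ENNReal.ofReal_ne_top
  have hWt : W ≠ ⊤ := setLIntegral_nnnorm_sq_cellShift_ne_top hf.continuous a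
  -- the sharp Poincaré inequality on the translated cube, additive form
  have hpoin : P * W ≤ G + P * ((ENNReal.ofReal s ^ 3)⁻¹ *
      (‖∫ y in cellShift s a, f y‖₊ : ℝ≥0∞) ^ 2) := local_poincare_cellShift hs hf a
  -- `‖∫_Q f‖ ≤ ∫_Q ‖f‖`
  have hB : (‖∫ y in cellShift s a, f y‖₊ : ℝ≥0∞) ≤ ∫⁻ y in cellShift s a, (‖f y‖₊ : ℝ≥0∞) := by
    have := enorm_integral_le_lintegral_enorm (μ := volume.restrict (cellShift s a)) f
    simpa only [enorm_eq_nnnorm] using this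
  have hS0 : ENNReal.ofReal s ^ 3 ≠ 0 := pow_ne_zero _ (ENNReal.ofReal_pos.2 hs).ne'
  have hSt : ENNReal.ofReal s ^ 3 ≠ ⊤ := ENNReal.pow_ne_top ENNReal.ofReal_ne_top
  have hB2 : (ENNReal.ofReal s ^ 3)⁻¹ * (‖∫ y in cellShift s a, f y‖₊ : ℝ≥0∞) ^ 2 ≤
      ENNReal.ofReal c₀ * W := by
    calc (ENNReal.ofReal s ^ 3)⁻¹ * (‖∫ y in cellShift s a, f y‖₊ : ℝ≥0∞) ^ 2
        ≤ (ENNReal.ofReal s ^ 3)⁻¹ * (∫⁻ y in cellShift s a, (‖f y‖₊ : ℝ≥0∞)) ^ 2 := by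
          gcongr
      _ ≤ (ENNReal.ofReal s ^ 3)⁻¹ * (ENNReal.ofReal (c₀ * s ^ 3) * W) := by
          gcongr
      _ = ENNReal.ofReal c₀ * W := by
          rw [ENNReal.ofReal_mul hc₀, ENNReal.ofReal_pow hs.le,
            mul_comm (ENNReal.ofReal c₀) (ENNReal.ofReal s ^ 3), mul_assoc,
            ← mul_assoc _ (ENNReal.ofReal s ^ 3), ENNReal.inv_mul_cancel hS0 hSt, one_mul]
  have h : P * W ≤ G + P * (ENNReal.ofReal c₀ * W) := hpoin.trans (by gcongr)
  have hct : ENNReal.ofReal c₀ < 1 := ENNReal.ofReal_lt_one.2 hc₁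
  have habs := ennreal_absorb hP0 hPt hct hWt h
  have h1c : 0 < 1 - c₀ := by linarith
  have hconst : (P * (1 - ENNReal.ofReal c₀))⁻¹ =
      ENNReal.ofReal (1 / Real.pi ^ 2 * s ^ 2 / (1 - c₀)) := by
    rw [hP_def, ← ENNReal.ofReal_one, ← ENNReal.ofReal_sub _ hc₀,
      ← ENNReal.ofReal_mul (by positivity), ← ENNReal.ofReal_inv_of_pos (mul_pos (by positivity) h1c)]
    congr 1
    have hπ : Real.pi ≠ 0 := Real.pi_ne_zero
    field_simp
  rwa [hconst] at habs

end BadMass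

open BadMass in
/-- **STUB `stub_badMass_le_sliceKinetic`** (line `birth` of crux `MicroscaleFlatness`,
stmt-AtomisticToContinuum-12842): Poincaré–Wirtinger kinetic localisation on bad cubes, with the
absolute constant `C = 1/π²`. For every trial state `Ψ` of `n+1` particles, every `L > 0`, `m ≥ 1`
and `0 < c₀ < 1`, the environment-integrated mass of the bad cubes (side `L/m`) of the slice
`y ↦ Ψ(y, X)` is at most `C (L/m)²/(1 - c₀) · ∫ dX ∫ dy |∇₀Ψ(y, X)|²`.
[cite: LSSY2005, Ch. 5 (5.15)–(5.17)] -/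
theorem stub_badMass_le_sliceKinetic :
    ∃ C : ℝ, 0 < C ∧ ∀ (n : ℕ) (L : ℝ) (m : ℕ) (c₀ : ℝ)
      (Ψ : Literature.MathematicalPhysics.QuantumManyBody.BoseGas.TrialState (n + 1) L),
      0 < L → 0 < m → 0 < c₀ → c₀ < 1 →
      (∫⁻ X : Fin n → EuclideanSpace ℝ (Fin 3), (∑ k : Fin 3 → Fin m, if (∫⁻ y in {y : EuclideanSpace ℝ (Fin 3) | ∀ i, y i ∈ Set.Ico ((k i : ℝ) * (L / m)) (((k i : ℝ) + 1) * (L / m))}, (‖Ψ.ψ (Matrix.vecCons y X)‖₊ : ENNReal)) ^ 2 < ENNReal.ofReal (c₀ * (L / m) ^ 3) * ∫⁻ y in {y : EuclideanSpace ℝ (Fin 3) | ∀ i, y i ∈ Set.Ico ((k i : ℝ) * (L / m)) (((k i : ℝ) + 1) * (L / m))}, (‖Ψ.ψ (Matrix.vecCons y X)‖₊ : ENNReal) ^ 2 then ∫⁻ y in {y : EuclideanSpace ℝ (Fin 3) | ∀ i, y i ∈ Set.Ico ((k i : ℝ) * (L / m)) (((k i : ℝ) + 1) * (L / m))}, (‖Ψ.ψ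 (Matrix.vecCons y X)‖₊ : ENNReal) ^ 2 else 0)) ≤
        ENNReal.ofReal (C * (L / m) ^ 2 / (1 - c₀)) *
          ∫⁻ X : Fin n → EuclideanSpace ℝ (Fin 3), ∫⁻ y : EuclideanSpace ℝ (Fin 3),
            Literature.MathematicalPhysics.QuantumManyBody.BoseGas.partialGradSq 0 Ψ.ψ (Matrix.vecCons y X) := by
  refine ⟨1 / Real.pi ^ 2, by positivity, ?_⟩
  intro n L m c₀ Ψ hL hm hc₀ hc₁
  have hmR : (0 : ℝ) < m := by exact_mod_cast hm
  set s : ℝ := L / m with hs_def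
  have hs : 0 < s := div_pos hL hmR
  set K : ℝ≥0∞ := ENNReal.ofReal (1 / Real.pi ^ 2 * s ^ 2 / (1 - c₀)) with hK_def
  have hdiff : Differentiable ℝ Ψ.ψ := Ψ.contDiff.differentiable one_ne_zero
  -- the cubes of the statement are the tree's sub-cells
  have hQ : ∀ k : Fin 3 → Fin m,
      {y : Space | ∀ i, y i ∈ Set.Ico (((k i : ℕ) : ℝ) * s) ((((k i : ℕ) : ℝ) + 1) * s)} =
        subCell s k := by
    intro k
    ext y
    simp only [Set.mem_setOf_eq, Set.mem_Ico, mem_subCell]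
    refine forall_congr' fun i => ?_
    rw [mul_comm (((k i : ℕ) : ℝ)) s, add_mul, one_mul, mul_comm (((k i : ℕ) : ℝ)) s]
  -- per slice
  have slice : ∀ X : Fin n → Space,
      (∑ k : Fin 3 → Fin m, if (∫⁻ y in {y : Space | ∀ i, y i ∈ Set.Ico (((k i : ℕ) : ℝ) * s) ((((k i : ℕ) : ℝ) + 1) * s)}, (‖Ψ.ψ (Matrix.vecCons y X)‖₊ : ℝ≥0∞)) ^ 2 < ENNReal.ofReal (c₀ * s ^ 3) * ∫⁻ y in {y : Space | ∀ i, y i ∈ Set.Ico (((k i : ℕ) : ℝ) * s) ((((k i : ℕ) : ℝ) + 1) * s)}, (‖Ψ.ψ (Matrix.vecCons y X)‖₊ : ℝ≥0∞) ^ 2 then ∫⁻ y in {y : Space | ∀ i, y i ∈ Set.Ico (((k i : ℕ) : ℝ) * s) ((((k i : ℕ) : ℝ) + 1) * s)}, (‖Ψ.ψ (Matrix.vecCons y X)‖₊ : ℝ≥0∞) ^ 2 else 0) ≤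
        K * ∫⁻ y : Space, partialGradSq 0 Ψ.ψ (Matrix.vecCons y X) := by
    intro X
    set f : Space → ℂ := fun y => Ψ.ψ (Matrix.vecCons y X) with hf_def
    have hfd : ContDiff ℝ 1 f := contDiff_vecCons_slice Ψ.contDiff X
    calc _ ≤ ∑ k : Fin 3 → Fin m, K * ∫⁻ y in subCell s k, gradSqC f y := by
          refine Finset.sum_le_sum fun k _ => ?_
          rw [hQ k]
          split_ifs with hbad
          · exact bad_cellShift_le hs hc₀.le hc₁ hfd (subOffset s k) hbad
          · exact bot_le
      _ = K * ∑ k : SubIdx m, ∫⁻ y in subCell s k, gradSqC f y := by rw [Finset.mul_sum]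
      _ ≤ K * ∫⁻ y, gradSqC f y := by
          gcongr
          exact sum_setLIntegral_subCell_le hs (measurable_gradSqC_any f).aemeasurable
      _ = K * ∫⁻ y : Space, partialGradSq 0 Ψ.ψ (Matrix.vecCons y X) := by
          simp only [hf_def, gradSqC_vecCons_eq_partialGradSq hdiff]
  -- integrate over the environment
  calc _ ≤ ∫⁻ X : Fin n → Space, K * ∫⁻ y : Space, partialGradSq 0 Ψ.ψ (Matrix.vecCons y X) :=
        lintegral_mono fun X => slice X
    _ = K * ∫⁻ X : Fin n → Space, ∫⁻ y : Space, partialGradSq 0 Ψ.ψ (Matrix.vecCons y X) :=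
        lintegral_const_mul' K _ ENNReal.ofReal_ne_top

end Summit.AtomisticToContinuum.BoseEinsteinCondensation.Theorems.MicroscaleFlatness

end
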